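import Summits.BirchSwinnertonDyer.BirchSwinnertonDyer.Theses.PrintCf2
import Summits.BirchSwinnertonDyer.BirchSwinnertonDyer.Theorems.PrintCf2RamifiedOffTYZJumpOneIsogeny
import HarnessLib

/-!
# Route `PrintCf2`, aside stmt-BirchSwinnertonDyer-23433 `RamifiedOffTYZOfFactsOfLevelTwo` — closed BY NAME (planner g17 TURNKEY)

Cell `bsd-print-cf2`, width seat `bsd-line-cf2-p1-w5` g3 (prover-bsd-line-cf2-p1-w5-g3-0), executing the planner's TURNKEY of
2026-08-28T21:39:16Z («to any idle prover (-w*, ty2, LEAD lineage): close aside stmt-BirchSwinnertonDyer-23433 by name»; RULING (aj):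
C⁺ at item level — items stmt-…-23431 `RamifiedJumpOneLevelTwoOfFacts` (crux #5) and stmt-…-23432 `RamifiedOffJumpOneOfFacts` (crux #6),
bridge = this aside). HONEST FRAMING: this is GLUE — the aside says «crux #5 → crux #6 → (𝔅_ram → the six in-bundle doors of skeleton v8)
→ `RamifiedOffTYZOfFacts`», and it is the tree theorem `Summit.BirchSwinnertonDyer.PrintCf2.ramifiedOffTYZOfFacts_of_leaves_of_levelTwo_of_offJumpOneIsogeny`
(cruxlead-20509 lineage, `Theorems/PrintCf2RamifiedOffTYZJumpOneIsogeny.lean`) with the six doors read off the displayed conjunction. No research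
content; the two cruxes stay open. No definition, no named fact, no `sorry`. BSD is not proved by any of this; no summit statement is proved by
this seat. beyond-print theorem: no.
-/

set_option linter.dupNamespace false

namespace Summit.BirchSwinnertonDyer.BirchSwinnertonDyer.Theorems

/-- **Aside stmt-BirchSwinnertonDyer-23433 `RamifiedOffTYZOfFactsOfLevelTwo`, by name**: crux #5 (`RamifiedJumpOneLevelTwoOfFacts`) and crux #6
(`RamifiedOffJumpOneOfFacts`) together with the six in-bundle doors (each displayed as a consequence of the print bundle `𝔅_ram`) give
`RamifiedOffTYZOfFacts` — the cruxlead lineage's assembly `ramifiedOffTYZOfFacts_of_leaves_of_levelTwo_of_offJumpOneIsogeny`, doors projected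
from the conjunction. [cite: TianYuanZhang2017, Thm. 1.2] [cite: ShuZhai2021, Thm. 1.1] -/
theorem ramifiedOffTYZOfFactsOfLevelTwo_proof :
    Summit.BirchSwinnertonDyer.BirchSwinnertonDyer.Theses.PrintCf2.RamifiedOffTYZOfFactsOfLevelTwo :=
  fun hL hO hD =>
    Summit.BirchSwinnertonDyer.PrintCf2.ramifiedOffTYZOfFacts_of_leaves_of_levelTwo_of_offJumpOneIsogeny
      (fun hB => (hD hB).1) (fun hB => (hD hB).2.1) (fun hB => (hD hB).2.2.1) (fun hB => (hD hB).2.2.2.1)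
      (fun hB => (hD hB).2.2.2.2.1) (fun hB => (hD hB).2.2.2.2.2) hL hO

end Summit.BirchSwinnertonDyer.BirchSwinnertonDyer.Theorems
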